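import Summits.BirchSwinnertonDyer.Rank1Residual.Additive.GordHigherLineMatching
import Summits.BirchSwinnertonDyer.Rank1Residual.AdditivePotMult.GreenbergVatsalTransferCountModelFree
import Summits.BirchSwinnertonDyer.Rank1Residual.AdditivePotMult.MixedCongruentPairGV
import Summits.BirchSwinnertonDyer.Rank1Residual.AdditivePotMult.PotMultRamifiedLineKummerEqAt
import HarnessLib

/-!
# The Greenberg–Vatsal transfer COUNT, `μ = 0` transfer and `λ^{Σ₀}` equality on congruent pairs with
# a (G-ord) member of ANY semistability defect — Gord × Gord and Gord × (M), `p ≥ 5`, off the swap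
# locus `(p − 1) ∣ lcm(e₁, e₂)`, modulo the R-D identification on the `e ∈ {3,4,6}` members
# (cell `b2b-bsdres`, team n1011, seat p07 (gen 7); row T-ROL-EXP FILE D; R3″ on Gord_e346 links
# 'λ-SHIFT TYPED mod hRD', TRANSPORT-TEMPLATE v2.0)

HONEST FRAMING (cell `b2b-bsdres`, run/shared/lean/b2b/bsd-rank1-residual/, verbatim in every
file): the goal of the cell is to DELETE the COMBINATION-SHAPED residual classes of the
Birch–Swinnerton-Dyer formula for ALL analytic-rank `≤ 1` elliptic curves over `ℚ` — "full BSD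
formula for every rank `≤ 1` curve in class `C`" assembled STRICTLY from published theorems — so
that the rank-`≤ 1` remainder becomes exactly the CONSTRUCTION-SHAPED classes, which are TYPED
(missing-input `Prop`s), NOT attempted. This is not "finishing BSD". Team n1011 (N10/N11, the (G-ord)
rows of every defect and the (M) rows): research route; labels and marks UNCHANGED; nothing booked.
TOOL theorems only: NO definition, NO named fact. CONDITIONAL on the tree's EXISTING named facts
exactly as the consumed files: A239 (`hGrK`, R-D on the (G-ord, `e = 2`) member), A40/A41 (`hT40`,
`hT41`, the (M) member); on an `e ∈ {3,4,6}` member the R-D identification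
`RamifiedLineKummerEqAt W p` stays an EXPLICIT binder (S2 + p05's piece 3, not in the tree).

## What and why

p12's model-free count (`GreenbergVatsalTransferCountModelFree`, p287579) proves GV p. 27's sentence
"`#Sel^{Σ₀}_{E₁}(ℚ_∞)_p[p] = #Sel^{Σ₀}_{E₂}(ℚ_∞)_p[p]` since `E₁[p] ≅ E₂[p]`" and its `μ` / `λ` /
cotorsion consequences for ANY congruent pair with MATCHING ramified ordinary lines (binder `hlines`).
Row T-ROL-EXP FILE C (`GordHigherLineMatching`) proves `hlines` on Gord × Gord and Gord × (M) links
at `p ≥ 5` off the swap locus (cc-typer-2's S3 + the inertia exponents). This file composes the two: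
for every such link the count, the `μ = 0` transfer to EVERY Selmer dual of the receiver, and the
`λ^{Σ₀}` equality — on (G-ord, `e ∈ {3,4,6}`) rows for the first time (before: `e = 2` only, via
twist models).

* §1 Gord × Gord: `natCard_torsionBy_nonPrimitiveSelmerInfty_eq_of_typeGOrd_typeGOrd_of_not_dvd_lcm`,
  `selmer_isTorsion_and_mu_eq_zero_…`, `nonPrimitive_lambdaInvariant_eq_…` (hRD₁, hRD₂ explicit);
  the receiver-`e346` / partner-`e = 2` form `…_of_semistabilityIndex_eq_two` with hRD₂ DISCHARGED by
  `ramifiedLineKummerEqAt_of_typeGOrd hGrK` and the side condition read `¬ (p−1) ∣ lcm(e₁, 2)`.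
* §2 Gord × (M) (receiver (G-ord), partner potentially multiplicative; hRD₂ DISCHARGED mod A40/A41 by
  `PotMult.ramifiedLineKummerEqAt`) and (M) × Gord (receiver (M)).

NOT here: the `λ`-reading `CongruentLambdaShift` / budgets / ENDs on e346 receivers (their Kato-direction
input is construction-shaped: class file N10 §5); links ON the swap locus; `p = 3` (defect 2 only,
twist-model theorems); the discharge of `hRD` on e346.

References: R. Greenberg, V. Vatsal, Invent. Math. 142 (2000) §2 Prop. (2.8), Remark (2.9), pp. 26–27
[GreenbergVatsal2000]; R. Greenberg, LNM 1716 (1999) Prop. 2.4, Prop. 5.10 [GreenbergLNM1716];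
M. Emerton, R. Pollack, T. Weston, Invent. Math. 163 (2006) pp. 2–3, §3.1 [EmertonPollackWeston2006];
cells/n1011/skel/T-ROL-EXP.md (67779f27699eb635); class-closure/N10/TRANSPORT-TEMPLATE.md v2.0.
-/

set_option autoImplicit false

noncomputable section

open scoped Classical NumberField AddSubgroup

open NumberField IsDedekindDomain Field WeierstrassCurve
  Literature.NumberTheory.GaloisRepresentations Literature.NumberTheory.EllipticCurves
  Literature.NumberTheory.EllipticCurves.GreenbergSelmer
  Literature.NumberTheory.EllipticCurves.Greenberg1999
  Literature.NumberTheory.EllipticCurves.GreenbergVatsal2000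
  Literature.NumberTheory.EllipticCurves.EmertonPollackWeston2006
  Literature.NumberTheory.EllipticCurves.Rank1Residual
  Summit.BirchSwinnertonDyer.Rank1Residual.X2.TorsionComparison
  Summit.BirchSwinnertonDyer.Rank1Residual.X2.GreenbergVatsalTorsion

namespace Summit.BirchSwinnertonDyer.Rank1Residual.Additive

open Summit.BirchSwinnertonDyer.Rank1Residual.X1.CongruenceTransfer (TorsionIso)
open GordHigherLineMatching

namespace GordHigherCongruentPairGV

/-! ### §1 Gord × Gord links of any defects, off the swap locus -/

section GordGord

variable {p : ℕ} [hp : Fact p.Prime] {W₁ W₂ : WeierstrassCurve ℚ} [W₁.IsElliptic] [W₁.IsGloballyMinimal]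
  [W₂.IsElliptic] [W₂.IsGloballyMinimal] (κ : ZpExtension ℚ p) {γ : absoluteGaloisGroup ℚ}
  (S₀ : Set (HeightOneSpectrum (𝓞 ℚ)))

/-- **GV p. 27 on a Gord × Gord link of ANY defects (`p ≥ 5`, off the swap locus):
`#Sel^{Σ₀}_{E₁}(ℚ_∞)_p[p] = #Sel^{Σ₀}_{E₂}(ℚ_∞)_p[p]`** — `E₁`, `E₂` globally minimal, additive at `p`
of type (G)-ordinary with `(p−1) ∤ lcm(e₁, e₂)`, `κ` cyclotomic, `E₁[p] ≅ E₂[p]` (`TorsionIso`),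
`p ∤ #E₁(ℚ)_tors`, both good outside `S₀ ∪ {p}`, modulo the R-D identifications `hRD₁`, `hRD₂`
(binders; on an `e = 2` member = `ramifiedLineKummerEqAt_of_typeGOrd hGrK`). p12's
`natCard_torsionBy_nonPrimitiveSelmerInfty_eq_of_matching` with `hlines` from FILE C.
[cite: GreenbergVatsal2000, §2 Prop. (2.8), Remark (2.9) and pp. 26–27] -/
theorem natCard_torsionBy_nonPrimitiveSelmerInfty_eq_of_typeGOrd_typeGOrd_of_not_dvd_lcm (hp5 : 5 ≤ p)
    (hκ : κ.IsCyclotomic) (hG₁ : TypeGOrd W₁ p) (hadd₁ : Addv W₁ p) (hG₂ : TypeGOrd W₂ p)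
    (hadd₂ : Addv W₂ p) (hlcm : ¬ (p - 1) ∣ Nat.lcm (semistabilityIndex W₁ p) (semistabilityIndex W₂ p))
    (hRD₁ : RamifiedLineKummerEqAt W₁ p) (hRD₂ : RamifiedLineKummerEqAt W₂ p)
    (htors₁ : ¬ p ∣ W₁.torsionOrder)
    (hS₀ : ∀ v ∈ S₀, ((p : ℕ) : 𝓞 ℚ) ∉ v.asIdeal)
    (hS₁ : ∀ v : HeightOneSpectrum (𝓞 ℚ), v ∉ S₀ → ((p : ℕ) : 𝓞 ℚ) ∉ v.asIdeal →
      W₁.HasGoodReductionAt v)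
    (hS₂ : ∀ v : HeightOneSpectrum (𝓞 ℚ), v ∉ S₀ → ((p : ℕ) : 𝓞 ℚ) ∉ v.asIdeal →
      W₂.HasGoodReductionAt v)
    (hT : TorsionIso W₁ W₂ p) :
    Nat.card ((nonPrimitiveSelmerInfty W₁ κ S₀)[(p : ℤ)]) =
      Nat.card ((nonPrimitiveSelmerInfty W₂ κ S₀)[(p : ℤ)]) :=
  natCard_torsionBy_nonPrimitiveSelmerInfty_eq_of_matching κ S₀ (by omega) hκ
    (forall_exists_lines_matching_of_typeGOrd_typeGOrd_of_not_dvd_lcm hp5 hG₁ hadd₁ hG₂ hadd₂ hlcm)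
    hRD₁ hRD₂ htors₁ hS₀ hS₁ hS₂ hT

/-- **`μ = 0` TRANSFER on a Gord × Gord link of any defects (`p ≥ 5`, off the swap locus; `κ`
cyclotomic with top generator `γ`; mod hRD₁, hRD₂): if a f.g. non-primitive dual of the partner `E₁`
is torsion with `μ = 0`, then EVERY Selmer dual `D₂` of the receiver `E₂` is torsion with `μ = 0`.**
[cite: GreenbergVatsal2000, §2 Prop. (2.8) and pp. 26–27] [cite: GreenbergLNM1716, Prop. 5.10 (p. 147)] -/
theorem selmer_isTorsion_and_mu_eq_zero_of_typeGOrd_typeGOrd_of_not_dvd_lcm (hp5 : 5 ≤ p)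
    (hκ : κ.IsCyclotomic) (hγ : κ.IsTopGenerator γ) (hG₁ : TypeGOrd W₁ p) (hadd₁ : Addv W₁ p)
    (hG₂ : TypeGOrd W₂ p) (hadd₂ : Addv W₂ p)
    (hlcm : ¬ (p - 1) ∣ Nat.lcm (semistabilityIndex W₁ p) (semistabilityIndex W₂ p))
    (hRD₁ : RamifiedLineKummerEqAt W₁ p) (hRD₂ : RamifiedLineKummerEqAt W₂ p)
    (htors₁ : ¬ p ∣ W₁.torsionOrder)
    (hS₀ : ∀ v ∈ S₀, ((p : ℕ) : 𝓞 ℚ) ∉ v.asIdeal)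
    (hS₁ : ∀ v : HeightOneSpectrum (𝓞 ℚ), v ∉ S₀ → ((p : ℕ) : 𝓞 ℚ) ∉ v.asIdeal →
      W₁.HasGoodReductionAt v)
    (hS₂ : ∀ v : HeightOneSpectrum (𝓞 ℚ), v ∉ S₀ → ((p : ℕ) : 𝓞 ℚ) ∉ v.asIdeal →
      W₂.HasGoodReductionAt v)
    (hT : TorsionIso W₁ W₂ p)
    (DS₁ : NonPrimitiveDualData W₁ κ γ S₀) [Module.Finite (IwasawaAlgebra p) DS₁.X]
    (ht₁ : Module.IsTorsion (IwasawaAlgebra p) DS₁.X) (hμ₁ : muInvariant p DS₁.X = 0)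
    (D₂ : W₂.SelmerDualData κ γ) : D₂.IsTorsion ∧ D₂.mu = 0 :=
  selmer_isTorsion_and_mu_eq_zero_of_matching κ S₀ (by omega) hκ hγ
    (forall_exists_lines_matching_of_typeGOrd_typeGOrd_of_not_dvd_lcm hp5 hG₁ hadd₁ hG₂ hadd₂ hlcm)
    hRD₁ hRD₂ htors₁ hS₀ hS₁ hS₂ hT DS₁ ht₁ hμ₁ D₂

/-- **`λ(X^{Σ₀}_1) = λ(X^{Σ₀}_2)` on a Gord × Gord link of any defects (`p ≥ 5`, off the swap locus;
mod hRD₁, hRD₂; `hnf_i` the no-finite-submodule binders as in p12's file), with the receiver's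
non-primitive dual torsion and `μ = 0`.** [cite: GreenbergVatsal2000, §2 Prop. (2.8) and pp. 26–27] -/
theorem nonPrimitive_lambdaInvariant_eq_of_typeGOrd_typeGOrd_of_not_dvd_lcm (hp5 : 5 ≤ p)
    (hκ : κ.IsCyclotomic) (hG₁ : TypeGOrd W₁ p) (hadd₁ : Addv W₁ p) (hG₂ : TypeGOrd W₂ p)
    (hadd₂ : Addv W₂ p) (hlcm : ¬ (p - 1) ∣ Nat.lcm (semistabilityIndex W₁ p) (semistabilityIndex W₂ p))
    (hRD₁ : RamifiedLineKummerEqAt W₁ p) (hRD₂ : RamifiedLineKummerEqAt W₂ p)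
    (htors₁ : ¬ p ∣ W₁.torsionOrder)
    (hS₀ : ∀ v ∈ S₀, ((p : ℕ) : 𝓞 ℚ) ∉ v.asIdeal)
    (hS₁ : ∀ v : HeightOneSpectrum (𝓞 ℚ), v ∉ S₀ → ((p : ℕ) : 𝓞 ℚ) ∉ v.asIdeal →
      W₁.HasGoodReductionAt v)
    (hS₂ : ∀ v : HeightOneSpectrum (𝓞 ℚ), v ∉ S₀ → ((p : ℕ) : 𝓞 ℚ) ∉ v.asIdeal →
      W₂.HasGoodReductionAt v)
    (hT : TorsionIso W₁ W₂ p)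
    (DS₁ : NonPrimitiveDualData W₁ κ γ S₀) (DS₂ : NonPrimitiveDualData W₂ κ γ S₀)
    [Module.Finite (IwasawaAlgebra p) DS₁.X] [Module.Finite (IwasawaAlgebra p) DS₂.X]
    (ht₁ : Module.IsTorsion (IwasawaAlgebra p) DS₁.X) (hμ₁ : muInvariant p DS₁.X = 0)
    (hnf₁ : ∀ N : Submodule (IwasawaAlgebra p) DS₁.X, Finite N → N = ⊥)
    (hnf₂ : ∀ N : Submodule (IwasawaAlgebra p) DS₂.X, Finite N → N = ⊥) :
    Module.IsTorsion (IwasawaAlgebra p) DS₂.X ∧ muInvariant p DS₂.X = 0 ∧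
      lambdaInvariant p DS₁.X = lambdaInvariant p DS₂.X :=
  nonPrimitive_lambdaInvariant_eq_of_matching κ S₀ (by omega) hκ
    (forall_exists_lines_matching_of_typeGOrd_typeGOrd_of_not_dvd_lcm hp5 hG₁ hadd₁ hG₂ hadd₂ hlcm)
    hRD₁ hRD₂ htors₁ hS₀ hS₁ hS₂ hT DS₁ DS₂ ht₁ hμ₁ hnf₁ hnf₂

/-- **Receiver `E₂` (G-ord) of ANY defect, partner `E₁` (G-ord, `e = 2`)** (the partner's R-D
identification DISCHARGED mod A239 by `ramifiedLineKummerEqAt_of_typeGOrd hGrK`; side condition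
`¬ (p−1) ∣ lcm(2, e₂)` — among the (G-ord) defects it fails exactly for `(p, e₂) ∈ {(5,4), (7,3), (7,6)}`):
`μ = 0` transfer to every Selmer dual of the receiver, mod hRD₂ only.
[cite: GreenbergVatsal2000, §2 Prop. (2.8) and pp. 26–27] [cite: GreenbergLNM1716, Prop. 2.4 and Prop. 5.10] -/
theorem selmer_isTorsion_and_mu_eq_zero_of_gordTwoPartner_of_not_dvd_lcm
    (hGrK : imKummer_ge_strictCondition_goodOrdinary) (hp5 : 5 ≤ p)
    (hκ : κ.IsCyclotomic) (hγ : κ.IsTopGenerator γ) (hG₁ : TypeGOrd W₁ p) (hadd₁ : Addv W₁ p)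
    (he₁ : semistabilityIndex W₁ p = 2) (hG₂ : TypeGOrd W₂ p) (hadd₂ : Addv W₂ p)
    (hlcm : ¬ (p - 1) ∣ Nat.lcm 2 (semistabilityIndex W₂ p))
    (hRD₂ : RamifiedLineKummerEqAt W₂ p) (htors₁ : ¬ p ∣ W₁.torsionOrder)
    (hS₀ : ∀ v ∈ S₀, ((p : ℕ) : 𝓞 ℚ) ∉ v.asIdeal)
    (hS₁ : ∀ v : HeightOneSpectrum (𝓞 ℚ), v ∉ S₀ → ((p : ℕ) : 𝓞 ℚ) ∉ v.asIdeal →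
      W₁.HasGoodReductionAt v)
    (hS₂ : ∀ v : HeightOneSpectrum (𝓞 ℚ), v ∉ S₀ → ((p : ℕ) : 𝓞 ℚ) ∉ v.asIdeal →
      W₂.HasGoodReductionAt v)
    (hT : TorsionIso W₁ W₂ p)
    (DS₁ : NonPrimitiveDualData W₁ κ γ S₀) [Module.Finite (IwasawaAlgebra p) DS₁.X]
    (ht₁ : Module.IsTorsion (IwasawaAlgebra p) DS₁.X) (hμ₁ : muInvariant p DS₁.X = 0)
    (D₂ : W₂.SelmerDualData κ γ) : D₂.IsTorsion ∧ D₂.mu = 0 :=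
  selmer_isTorsion_and_mu_eq_zero_of_typeGOrd_typeGOrd_of_not_dvd_lcm κ S₀ hp5 hκ hγ hG₁ hadd₁ hG₂ hadd₂
    (by rwa [he₁])
    (AdditivePotMult.ramifiedLineKummerEqAt_of_typeGOrd hGrK (by omega) hG₁ hadd₁ he₁) hRD₂ htors₁ hS₀
    hS₁ hS₂ hT DS₁ ht₁ hμ₁ D₂

end GordGord

end GordHigherCongruentPairGV

end Summit.BirchSwinnertonDyer.Rank1Residual.Additive

/-! ### §2 Gord × (M) and (M) × Gord links (mod A40/A41) -/

namespace Summit.BirchSwinnertonDyer.Rank1Residual.AdditivePotMult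

open Summit.BirchSwinnertonDyer.Rank1Residual.X1.CongruenceTransfer (TorsionIso)
open Summit.BirchSwinnertonDyer.Rank1Residual.Additive
open GordHigherLineMatching

namespace GordHigherCongruentPairGV

variable {p : ℕ} [hp : Fact p.Prime] {W₁ W₂ : WeierstrassCurve ℚ} [W₁.IsElliptic] [W₂.IsElliptic]
  (κ : ZpExtension ℚ p) {γ : absoluteGaloisGroup ℚ} (S₀ : Set (HeightOneSpectrum (𝓞 ℚ)))

/-- **Receiver `E₂` potentially multiplicative, partner `E₁` (G-ord) of ANY defect** (`p ≥ 5`,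
`¬ (p−1) ∣ lcm(e₁, 2)`; the receiver's R-D identification DISCHARGED mod A40/A41 by
`PotMult.ramifiedLineKummerEqAt`, the partner's `hRD₁` an explicit binder): `μ = 0` transfer to EVERY
Selmer dual of the receiver. [cite: GreenbergVatsal2000, §2 pp. 14–15, Prop. (2.8) and pp. 26–27]
[cite: SilvermanATAEC1994, Ch. V Thm. 5.3, Cor. 5.4] -/
theorem selmer_isTorsion_and_mu_eq_zero_of_typeGOrd_potMult_of_not_dvd_lcm [W₁.IsGloballyMinimal]
    (hT40 : Silverman1994_thmV53_tateUniformisation.{0})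
    (hT41 : Silverman1994_thmV53_corV54_tateUniformisation.{0}) (hp5 : 5 ≤ p)
    (hκ : κ.IsCyclotomic) (hγ : κ.IsTopGenerator γ) (hG₁ : TypeGOrd W₁ p) (hadd₁ : Addv W₁ p)
    (hpm₂ : PotMult W₂ p) (hlcm : ¬ (p - 1) ∣ Nat.lcm (semistabilityIndex W₁ p) 2)
    (hRD₁ : RamifiedLineKummerEqAt W₁ p) (htors₁ : ¬ p ∣ W₁.torsionOrder)
    (hS₀ : ∀ v ∈ S₀, ((p : ℕ) : 𝓞 ℚ) ∉ v.asIdeal)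
    (hS₁ : ∀ v : HeightOneSpectrum (𝓞 ℚ), v ∉ S₀ → ((p : ℕ) : 𝓞 ℚ) ∉ v.asIdeal →
      W₁.HasGoodReductionAt v)
    (hS₂ : ∀ v : HeightOneSpectrum (𝓞 ℚ), v ∉ S₀ → ((p : ℕ) : 𝓞 ℚ) ∉ v.asIdeal →
      W₂.HasGoodReductionAt v)
    (hT : TorsionIso W₁ W₂ p)
    (DS₁ : NonPrimitiveDualData W₁ κ γ S₀) [Module.Finite (IwasawaAlgebra p) DS₁.X]
    (ht₁ : Module.IsTorsion (IwasawaAlgebra p) DS₁.X) (hμ₁ : muInvariant p DS₁.X = 0)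
    (D₂ : W₂.SelmerDualData κ γ) : D₂.IsTorsion ∧ D₂.mu = 0 :=
  selmer_isTorsion_and_mu_eq_zero_of_matching κ S₀ (by omega) hκ hγ
    (forall_exists_lines_matching_of_typeGOrd_potMult_of_not_dvd_lcm hT40 hT41 hp5 hG₁ hadd₁ hpm₂ hlcm)
    hRD₁ (hpm₂.ramifiedLineKummerEqAt hT40 hT41 (by omega)) htors₁ hS₀ hS₁ hS₂ hT DS₁ ht₁ hμ₁ D₂

/-- **The COUNT on a Gord × (M) link** (`p ≥ 5`, off the swap locus; receiver's hRD mod A40/A41,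
partner's `hRD₁` explicit): `#Sel^{Σ₀}_{E₁}(ℚ_∞)_p[p] = #Sel^{Σ₀}_{E₂}(ℚ_∞)_p[p]`.
[cite: GreenbergVatsal2000, §2 Prop. (2.8), Remark (2.9) and pp. 26–27] -/
theorem natCard_torsionBy_nonPrimitiveSelmerInfty_eq_of_typeGOrd_potMult_of_not_dvd_lcm
    [W₁.IsGloballyMinimal] (hT40 : Silverman1994_thmV53_tateUniformisation.{0})
    (hT41 : Silverman1994_thmV53_corV54_tateUniformisation.{0}) (hp5 : 5 ≤ p)
    (hκ : κ.IsCyclotomic) (hG₁ : TypeGOrd W₁ p) (hadd₁ : Addv W₁ p) (hpm₂ : PotMult W₂ p)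
    (hlcm : ¬ (p - 1) ∣ Nat.lcm (semistabilityIndex W₁ p) 2)
    (hRD₁ : RamifiedLineKummerEqAt W₁ p) (htors₁ : ¬ p ∣ W₁.torsionOrder)
    (hS₀ : ∀ v ∈ S₀, ((p : ℕ) : 𝓞 ℚ) ∉ v.asIdeal)
    (hS₁ : ∀ v : HeightOneSpectrum (𝓞 ℚ), v ∉ S₀ → ((p : ℕ) : 𝓞 ℚ) ∉ v.asIdeal →
      W₁.HasGoodReductionAt v)
    (hS₂ : ∀ v : HeightOneSpectrum (𝓞 ℚ), v ∉ S₀ → ((p : ℕ) : 𝓞 ℚ) ∉ v.asIdeal →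
      W₂.HasGoodReductionAt v)
    (hT : TorsionIso W₁ W₂ p) :
    Nat.card ((nonPrimitiveSelmerInfty W₁ κ S₀)[(p : ℤ)]) =
      Nat.card ((nonPrimitiveSelmerInfty W₂ κ S₀)[(p : ℤ)]) :=
  natCard_torsionBy_nonPrimitiveSelmerInfty_eq_of_matching κ S₀ (by omega) hκ
    (forall_exists_lines_matching_of_typeGOrd_potMult_of_not_dvd_lcm hT40 hT41 hp5 hG₁ hadd₁ hpm₂ hlcm)
    hRD₁ (hpm₂.ramifiedLineKummerEqAt hT40 hT41 (by omega)) htors₁ hS₀ hS₁ hS₂ hT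

/-- **Receiver `E₂` (G-ord) of ANY defect, partner `E₁` potentially multiplicative** (`p ≥ 5`,
`¬ (p−1) ∣ lcm(2, e₂)`; partner's R-D mod A40/A41, receiver's `hRD₂` explicit — discharged on
`e₂ = 2` by `ramifiedLineKummerEqAt_of_typeGOrd hGrK`): `μ = 0` transfer to EVERY Selmer dual of
the receiver; `p ∤ #E₁(ℚ)_tors` as in GV. [cite: GreenbergVatsal2000, §2 pp. 14–15, Prop. (2.8) and pp. 26–27]
[cite: SilvermanATAEC1994, Ch. V Thm. 5.3, Cor. 5.4] -/
theorem selmer_isTorsion_and_mu_eq_zero_of_potMult_typeGOrd_of_not_dvd_lcm [W₂.IsGloballyMinimal]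
    (hT40 : Silverman1994_thmV53_tateUniformisation.{0})
    (hT41 : Silverman1994_thmV53_corV54_tateUniformisation.{0}) (hp5 : 5 ≤ p)
    (hκ : κ.IsCyclotomic) (hγ : κ.IsTopGenerator γ) (hpm₁ : PotMult W₁ p) (hG₂ : TypeGOrd W₂ p)
    (hadd₂ : Addv W₂ p) (hlcm : ¬ (p - 1) ∣ Nat.lcm 2 (semistabilityIndex W₂ p))
    (hRD₂ : RamifiedLineKummerEqAt W₂ p) (htors₁ : ¬ p ∣ W₁.torsionOrder)
    (hS₀ : ∀ v ∈ S₀, ((p : ℕ) : 𝓞 ℚ) ∉ v.asIdeal)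
    (hS₁ : ∀ v : HeightOneSpectrum (𝓞 ℚ), v ∉ S₀ → ((p : ℕ) : 𝓞 ℚ) ∉ v.asIdeal →
      W₁.HasGoodReductionAt v)
    (hS₂ : ∀ v : HeightOneSpectrum (𝓞 ℚ), v ∉ S₀ → ((p : ℕ) : 𝓞 ℚ) ∉ v.asIdeal →
      W₂.HasGoodReductionAt v)
    (hT : TorsionIso W₁ W₂ p)
    (DS₁ : NonPrimitiveDualData W₁ κ γ S₀) [Module.Finite (IwasawaAlgebra p) DS₁.X]
    (ht₁ : Module.IsTorsion (IwasawaAlgebra p) DS₁.X) (hμ₁ : muInvariant p DS₁.X = 0)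
    (D₂ : W₂.SelmerDualData κ γ) : D₂.IsTorsion ∧ D₂.mu = 0 :=
  selmer_isTorsion_and_mu_eq_zero_of_matching κ S₀ (by omega) hκ hγ
    (forall_exists_lines_matching_of_potMult_typeGOrd_of_not_dvd_lcm hT40 hT41 hp5 hpm₁ hG₂ hadd₂ hlcm)
    (hpm₁.ramifiedLineKummerEqAt hT40 hT41 (by omega)) hRD₂ htors₁ hS₀ hS₁ hS₂ hT DS₁ ht₁ hμ₁ D₂

/-- **`λ(X^{Σ₀}_1) = λ(X^{Σ₀}_2)` on an (M) × Gord link** (receiver (G-ord) of any defect, partner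
potentially multiplicative; `p ≥ 5`, off the swap locus; mod A40/A41 + `hRD₂`).
[cite: GreenbergVatsal2000, §2 Prop. (2.8) and pp. 26–27] -/
theorem nonPrimitive_lambdaInvariant_eq_of_potMult_typeGOrd_of_not_dvd_lcm [W₂.IsGloballyMinimal]
    (hT40 : Silverman1994_thmV53_tateUniformisation.{0})
    (hT41 : Silverman1994_thmV53_corV54_tateUniformisation.{0}) (hp5 : 5 ≤ p)
    (hκ : κ.IsCyclotomic) (hpm₁ : PotMult W₁ p) (hG₂ : TypeGOrd W₂ p) (hadd₂ : Addv W₂ p)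
    (hlcm : ¬ (p - 1) ∣ Nat.lcm 2 (semistabilityIndex W₂ p))
    (hRD₂ : RamifiedLineKummerEqAt W₂ p) (htors₁ : ¬ p ∣ W₁.torsionOrder)
    (hS₀ : ∀ v ∈ S₀, ((p : ℕ) : 𝓞 ℚ) ∉ v.asIdeal)
    (hS₁ : ∀ v : HeightOneSpectrum (𝓞 ℚ), v ∉ S₀ → ((p : ℕ) : 𝓞 ℚ) ∉ v.asIdeal →
      W₁.HasGoodReductionAt v)
    (hS₂ : ∀ v : HeightOneSpectrum (𝓞 ℚ), v ∉ S₀ → ((p : ℕ) : 𝓞 ℚ) ∉ v.asIdeal →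
      W₂.HasGoodReductionAt v)
    (hT : TorsionIso W₁ W₂ p)
    (DS₁ : NonPrimitiveDualData W₁ κ γ S₀) (DS₂ : NonPrimitiveDualData W₂ κ γ S₀)
    [Module.Finite (IwasawaAlgebra p) DS₁.X] [Module.Finite (IwasawaAlgebra p) DS₂.X]
    (ht₁ : Module.IsTorsion (IwasawaAlgebra p) DS₁.X) (hμ₁ : muInvariant p DS₁.X = 0)
    (hnf₁ : ∀ N : Submodule (IwasawaAlgebra p) DS₁.X, Finite N → N = ⊥)
    (hnf₂ : ∀ N : Submodule (IwasawaAlgebra p) DS₂.X, Finite N → N = ⊥) :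
    Module.IsTorsion (IwasawaAlgebra p) DS₂.X ∧ muInvariant p DS₂.X = 0 ∧
      lambdaInvariant p DS₁.X = lambdaInvariant p DS₂.X :=
  nonPrimitive_lambdaInvariant_eq_of_matching κ S₀ (by omega) hκ
    (forall_exists_lines_matching_of_potMult_typeGOrd_of_not_dvd_lcm hT40 hT41 hp5 hpm₁ hG₂ hadd₂ hlcm)
    (hpm₁.ramifiedLineKummerEqAt hT40 hT41 (by omega)) hRD₂ htors₁ hS₀ hS₁ hS₂ hT DS₁ DS₂ ht₁ hμ₁ hnf₁
    hnf₂

end GordHigherCongruentPairGV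

end Summit.BirchSwinnertonDyer.Rank1Residual.AdditivePotMult

end
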